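import Mathlib
import HarnessLib
import Summits.NavierStokesRegularity.NavierStokesRegularity.Theorems.FrequencyGrowthExponent.Negative.Reductions
import Summits.NavierStokesRegularity.NavierStokesRegularity.Theorems.FrequencyGrowthExponent.Negative.Strata
import Summits.NavierStokesRegularity.NavierStokesRegularity.Theorems.AxisTwistDoorTiltDominationLocSymmetryExclusions
import Summits.NavierStokesRegularity.NavierStokesRegularity.Theorems.PoloidalWindowDoorPoloidalWindowRigidityAnyAxis
import Summits.NavierStokesRegularity.NavierStokesRegularity.Theorems.ClockStretchingLawClockCeilingOpenSetVorticityLiouville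
import Summits.NavierStokesRegularity.NavierStokesRegularity.Theorems.ScenarioCensusPeriodicGauge
import Summits.NavierStokesRegularity.NavierStokesRegularity.Theorems.ScenarioCensusHelicalTypeILiouville
import Summits.NavierStokesRegularity.NavierStokesRegularity.Theorems.DssFarFieldSlavingBlowupTypeIDssProfileSimilarityEnstrophyTimeOnlyThreshold

/-!
# Crux `FrequencyGrowthExponent` (stmt-NavierStokesRegularity-27893), negative side:
# rigidity of the class — symmetric, recurrent and locally degenerate profiles carry no vortex loop

Negative-side (cdisprove, D-0016) bookkeeping for the wall `LoopPeriodRatchet.FrequencyGrowthExponent`; nothing here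
closes or changes any item (`--supports`).  By `Negative/Reductions.not_frequencyGrowthExponent_iff` refuting the wall
means CONSTRUCTING `W = HasClassLoop` (an e₃-poloidal Type-I Oseen-mild ancient profile one of whose slices carries a
non-stationary closed vortex line).  `Negative/Strata` placed `W` off four strata; this file adds, as kernel-checked
corollaries of Liouville and rigidity theorems ALREADY IN THE TREE (all over the genuine KNSS-gauge class
`IsTypeIAncientMild`, reached from the class binders by `isTypeIAncientMild_of_class`), seven more places where `W`
cannot live — each stated as «such a profile vanishes identically» and as «no slice carries a vortex loop»
(time-recurrent germs and germ rigidity follow in `Negative/Recurrence`):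

* **explicit amplitude threshold** `eq_zero_of_rate_lt_one` / `one_le_typeI_constant_of_isVortexLoop` — Type-I time
  constant `C < 1` (unit viscosity) forces `v ≡ 0` (`SimilarityEnstrophy.typeI_ancient_eq_zero_of_rate_lt_one`): every
  witness has `C ≥ 1`;
* **backward self-similar** profiles (`c • v(c²t, c x) = v(t,x)`, all `c > 0`) — `…SymmetryExclusions.eq_zero_of_selfSimilar`
  (Tsai 1998 in the Oseen gauge);
* **spatially periodic** profiles (ONE non-zero period vector) — `ScenarioCensus.PeriodicGauge.periodic_typeI_liouville_genuine`;
* **helical** profiles (screw symmetry of pitch `h ≠ 0` about vertical axes, moving axes allowed) —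
  `ScenarioCensus.PitchDefect.helical_typeI_liouville_genuine`;
* e₃-poloidal profiles **one slice of which is axisymmetric about some axis** (any direction, any centre) —
  `…PoloidalWindowRigidityAnyAxis.eq_zero_of_axisymmetric_anyAxis_slice`;
* **locally irrotational slices** (`curl v(t₀,·) = 0` on a non-empty open set of ONE slice; in particular vortex
  rings with potential flow outside a compact core) — `openSetVorticityLiouville`;
* **locally vanishing slices** (`v(t₀,·) = 0` on a non-empty open set) — `openSetVelocityLiouville`;

HONEST FRAMING: corollaries of landed theorems, recorded for the W-census of the negation-first reading (req192);
nothing here bears on `PoloidalWindowDoor.Target` or on Navier–Stokes regularity; item 27893 stays OPEN.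
-/

noncomputable section

-- the summit and its single sub-problem share the name (CONVENTIONS §1), as in every Theorems file
set_option linter.dupNamespace false

namespace Summit.NavierStokesRegularity.NavierStokesRegularity.Theorems.FrequencyGrowthExponent.Negative

open Set Function Filter Topology MeasureTheory
open scoped RealInnerProductSpace InnerProductSpace
open Literature.Analysis Literature.Analysis.FluidPDE Literature.Analysis.UnboundedOperators
open Summit.NavierStokesRegularity.NavierStokesRegularity.Theorems
open Summit.NavierStokesRegularity.NavierStokesRegularity.Theorems.PoloidalWindowDoorPoloidalWindowRigidityWindow

variable {C : ℝ} {v : ℝ → EuclideanSpace ℝ (Fin 3) → EuclideanSpace ℝ (Fin 3)}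

/-! ### A vanishing profile carries no loop -/

/-- A profile vanishing on the past carries no vortex loop on any slice `t < 0`. -/
theorem no_loop_of_eq_zero (hzero : ∀ t < 0, ∀ y, v t y = 0) {t : ℝ} (ht : t < 0)
    (c : ℝ → EuclideanSpace ℝ (Fin 3)) (T : ℝ) : ¬ IsVortexLoop v t c T := fun h =>
  no_nonstationary_vortexLine_of_curl_eq_zero (curl_eq_zero_of_eq_zero hzero) ht c h.2.2.2

/-! ### The explicit amplitude threshold `C ≥ 1` -/

/-- **Time-rate constant below one forces triviality.** A class profile (Type-I rate `C/√(−t)`, continuity on the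
open past slab, unit-viscosity Oseen–Duhamel identity, divergence-free slices) with `C < 1` vanishes identically.
[cite: KochNadirashviliSereginSverak2009, §1 p. 3 and (1.4) (arXiv:0709.3599)] -/
theorem eq_zero_of_rate_lt_one (hrate : HasTypeITimeDecay C v)
    (hcont : ContinuousOn (uncurry v) (Iio (0 : ℝ) ×ˢ univ))
    (hmild : ∀ s t : ℝ, s < t → t < 0 → ∀ x, v t x = heatExtension (v s) (t - s) x - oseenDuhamel 1 s v v t x)
    (hdiv : ∀ t < 0, VectorCalculus.IsDivFree (v t)) (hC : C < 1) : ∀ t < 0, ∀ x, v t x = 0 :=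
  SimilarityEnstrophy.typeI_ancient_eq_zero_of_rate_lt_one (isTypeIAncientMild_of_class hrate hcont hmild hdiv) hC

/-- **No loop below rate one.** -/
theorem no_loop_of_rate_lt_one (hrate : HasTypeITimeDecay C v)
    (hcont : ContinuousOn (uncurry v) (Iio (0 : ℝ) ×ˢ univ))
    (hmild : ∀ s t : ℝ, s < t → t < 0 → ∀ x, v t x = heatExtension (v s) (t - s) x - oseenDuhamel 1 s v v t x)
    (hdiv : ∀ t < 0, VectorCalculus.IsDivFree (v t)) (hC : C < 1) {t : ℝ} (ht : t < 0)
    (c : ℝ → EuclideanSpace ℝ (Fin 3)) (T : ℝ) : ¬ IsVortexLoop v t c T :=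
  no_loop_of_eq_zero (eq_zero_of_rate_lt_one hrate hcont hmild hdiv hC) ht c T

/-- **Every witness has Type-I constant at least one**: if a class profile carries a vortex loop on some slice
`t < 0`, then `1 ≤ C`. -/
theorem one_le_typeI_constant_of_isVortexLoop (hrate : HasTypeITimeDecay C v)
    (hcont : ContinuousOn (uncurry v) (Iio (0 : ℝ) ×ˢ univ))
    (hmild : ∀ s t : ℝ, s < t → t < 0 → ∀ x, v t x = heatExtension (v s) (t - s) x - oseenDuhamel 1 s v v t x)
    (hdiv : ∀ t < 0, VectorCalculus.IsDivFree (v t)) {t : ℝ} (ht : t < 0) {c : ℝ → EuclideanSpace ℝ (Fin 3)}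
    {T : ℝ} (hloop : IsVortexLoop v t c T) : 1 ≤ C :=
  le_of_not_gt fun hC => no_loop_of_rate_lt_one hrate hcont hmild hdiv hC ht c T hloop

/-! ### Symmetric strata -/

/-- **Backward self-similar profiles carry no loop** (`c • v(c²t, c x) = v(t,x)` for all `c > 0`, `t < 0`):
such a class profile vanishes identically (Tsai's theorem in the Oseen gauge). [cite: Tsai1998, Thm 1 (p. 31)] -/
theorem no_loop_of_selfSimilar (hrate : HasTypeITimeDecay C v)
    (hcont : ContinuousOn (uncurry v) (Iio (0 : ℝ) ×ˢ univ))
    (hmild : ∀ s t : ℝ, s < t → t < 0 → ∀ x, v t x = heatExtension (v s) (t - s) x - oseenDuhamel 1 s v v t x)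
    (hdiv : ∀ t < 0, VectorCalculus.IsDivFree (v t))
    (hss : ∀ a : ℝ, 0 < a → ∀ t < (0 : ℝ), ∀ x : EuclideanSpace ℝ (Fin 3), a • v (a ^ 2 * t) (a • x) = v t x)
    {t : ℝ} (ht : t < 0) (c : ℝ → EuclideanSpace ℝ (Fin 3)) (T : ℝ) : ¬ IsVortexLoop v t c T :=
  no_loop_of_eq_zero
    (AxisTwistDoorTiltDominationLocSymmetryExclusions.eq_zero_of_selfSimilar hrate hcont hmild hdiv hss) ht c T

/-- **Spatially periodic profiles vanish** (one non-zero period vector `L`: `v(t, x + L) = v(t, x)` for all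
`t < 0`). [cite: KochNadirashviliSereginSverak2009, §1 p. 3 and Thm 6.2 (arXiv:0709.3599)] -/
theorem eq_zero_of_periodic (hrate : HasTypeITimeDecay C v)
    (hcont : ContinuousOn (uncurry v) (Iio (0 : ℝ) ×ˢ univ))
    (hmild : ∀ s t : ℝ, s < t → t < 0 → ∀ x, v t x = heatExtension (v s) (t - s) x - oseenDuhamel 1 s v v t x)
    (hdiv : ∀ t < 0, VectorCalculus.IsDivFree (v t)) {L : EuclideanSpace ℝ (Fin 3)} (hL : L ≠ 0)
    (hper : ∀ t < 0, ∀ x, v t (x + L) = v t x) : ∀ t < 0, ∀ x, v t x = 0 :=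
  ScenarioCensus.PeriodicGauge.periodic_typeI_liouville_genuine C v
    (isTypeIAncientMild_of_class hrate hcont hmild hdiv) L hL hper

/-- **Spatially periodic profiles carry no loop** (in particular no lattice, array or `x₃`-periodic bank of rings is
a witness). -/
theorem no_loop_of_periodic (hrate : HasTypeITimeDecay C v)
    (hcont : ContinuousOn (uncurry v) (Iio (0 : ℝ) ×ˢ univ))
    (hmild : ∀ s t : ℝ, s < t → t < 0 → ∀ x, v t x = heatExtension (v s) (t - s) x - oseenDuhamel 1 s v v t x)
    (hdiv : ∀ t < 0, VectorCalculus.IsDivFree (v t)) {L : EuclideanSpace ℝ (Fin 3)} (hL : L ≠ 0)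
    (hper : ∀ t < 0, ∀ x, v t (x + L) = v t x) {t : ℝ} (ht : t < 0) (c : ℝ → EuclideanSpace ℝ (Fin 3)) (T : ℝ) :
    ¬ IsVortexLoop v t c T :=
  no_loop_of_eq_zero (eq_zero_of_periodic hrate hcont hmild hdiv hL hper) ht c T

/-- **Helical profiles vanish**: screw symmetry of pitch `h ≠ 0` about the vertical axes through the (possibly
moving) points `−A(τ)` — `v(τ, R_θ y + (R_θ A(τ) − A(τ)) + hθ e₃) = R_θ v(τ, y)` for all `θ`, `τ < 0` — forces a
class profile to vanish identically (the pitch-defect proof of the helical Type-I Liouville theorem).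
[cite: KochNadirashviliSereginSverak2009, §1 p. 3 and Thm 6.2 (arXiv:0709.3599)] -/
theorem eq_zero_of_helical (hrate : HasTypeITimeDecay C v)
    (hcont : ContinuousOn (uncurry v) (Iio (0 : ℝ) ×ˢ univ))
    (hmild : ∀ s t : ℝ, s < t → t < 0 → ∀ x, v t x = heatExtension (v s) (t - s) x - oseenDuhamel 1 s v v t x)
    (hdiv : ∀ t < 0, VectorCalculus.IsDivFree (v t)) {h : ℝ} (hh : h ≠ 0) {A : ℝ → EuclideanSpace ℝ (Fin 3)}
    (hhel : ∀ τ < 0, ∀ (θ : ℝ) (y : EuclideanSpace ℝ (Fin 3)),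
      v τ (rotZ θ y + (rotZ θ (A τ) - A τ + (h * θ) • EuclideanSpace.single 2 (1 : ℝ))) = rotZ θ (v τ y)) :
    ∀ t < 0, ∀ x, v t x = 0 :=
  ScenarioCensus.PitchDefect.helical_typeI_liouville_genuine hh (isTypeIAncientMild_of_class hrate hcont hmild hdiv) hhel

/-- **Helical profiles carry no loop.** -/
theorem no_loop_of_helical (hrate : HasTypeITimeDecay C v)
    (hcont : ContinuousOn (uncurry v) (Iio (0 : ℝ) ×ˢ univ))
    (hmild : ∀ s t : ℝ, s < t → t < 0 → ∀ x, v t x = heatExtension (v s) (t - s) x - oseenDuhamel 1 s v v t x)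
    (hdiv : ∀ t < 0, VectorCalculus.IsDivFree (v t)) {h : ℝ} (hh : h ≠ 0) {A : ℝ → EuclideanSpace ℝ (Fin 3)}
    (hhel : ∀ τ < 0, ∀ (θ : ℝ) (y : EuclideanSpace ℝ (Fin 3)),
      v τ (rotZ θ y + (rotZ θ (A τ) - A τ + (h * θ) • EuclideanSpace.single 2 (1 : ℝ))) = rotZ θ (v τ y))
    {t : ℝ} (ht : t < 0) (c : ℝ → EuclideanSpace ℝ (Fin 3)) (T : ℝ) : ¬ IsVortexLoop v t c T :=
  no_loop_of_eq_zero (eq_zero_of_helical hrate hcont hmild hdiv hh hhel) ht c T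

/-- **One axisymmetric slice about any axis kills an e₃-poloidal profile's loops**: if some slice `v(s,·)`, `s < 0`,
is axisymmetric about the axis `{L(r e₃) + c₀}` (any linear isometry `L`, any centre `c₀`), the profile vanishes
identically, so no slice carries a vortex loop. [cite: KochNadirashviliSereginSverak2009, Thm 5.2 (arXiv:0709.3599)] -/
theorem no_loop_of_axisymmetric_slice_anyAxis (hrate : HasTypeITimeDecay C v)
    (hcont : ContinuousOn (uncurry v) (Iio (0 : ℝ) ×ˢ univ))
    (hmild : ∀ s t : ℝ, s < t → t < 0 → ∀ x, v t x = heatExtension (v s) (t - s) x - oseenDuhamel 1 s v v t x)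
    (hdiv : ∀ t < 0, VectorCalculus.IsDivFree (v t))
    (hpol : ∀ s < 0, ∀ y, ⟪curl (v s) y, EuclideanSpace.single 2 1⟫_ℝ = 0)
    (L : EuclideanSpace ℝ (Fin 3) ≃ₗᵢ[ℝ] EuclideanSpace ℝ (Fin 3)) (c₀ : EuclideanSpace ℝ (Fin 3))
    {s : ℝ} (hs : s < 0) (haxi : IsAxisymmetric (fun y => L.symm (v s (L y + c₀))))
    {t : ℝ} (ht : t < 0) (c : ℝ → EuclideanSpace ℝ (Fin 3)) (T : ℝ) : ¬ IsVortexLoop v t c T :=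
  no_loop_of_eq_zero
    (PoloidalWindowDoorPoloidalWindowRigidityAnyAxis.eq_zero_of_axisymmetric_anyAxis_slice
      hrate hcont hmild hdiv hpol L c₀ hs haxi) ht c T

/-! ### Unique continuation -/

/-- **A locally irrotational slice kills the profile**: if `curl v(t₀, ·) = 0` on a non-empty open set for ONE
`t₀ < 0` (e.g. a vortex ring surrounded by potential flow), the class profile vanishes identically (slices are
real-analytic; an irrotational bounded divergence-free slice is constant; constants are not in the gauge).
[cite: KochNadirashviliSereginSverak2009, Lemma 3.1 and Remark 6.1 (arXiv:0709.3599)] -/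
theorem eq_zero_of_openSet_curl_eq_zero (hrate : HasTypeITimeDecay C v)
    (hcont : ContinuousOn (uncurry v) (Iio (0 : ℝ) ×ˢ univ))
    (hmild : ∀ s t : ℝ, s < t → t < 0 → ∀ x, v t x = heatExtension (v s) (t - s) x - oseenDuhamel 1 s v v t x)
    (hdiv : ∀ t < 0, VectorCalculus.IsDivFree (v t)) {t₀ : ℝ} (ht₀ : t₀ < 0)
    {U : Set (EuclideanSpace ℝ (Fin 3))} (hU : IsOpen U) (hne : U.Nonempty) (hcurl : ∀ x ∈ U, curl (v t₀) x = 0) :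
    ∀ t < 0, ∀ x, v t x = 0 :=
  openSetVorticityLiouville (isTypeIAncientMild_of_class hrate hcont hmild hdiv) ht₀ hU hne hcurl

/-- **Locally irrotational slices carry no loop**: a witness has vorticity non-zero on a dense subset of every
slice. -/
theorem no_loop_of_openSet_curl_eq_zero (hrate : HasTypeITimeDecay C v)
    (hcont : ContinuousOn (uncurry v) (Iio (0 : ℝ) ×ˢ univ))
    (hmild : ∀ s t : ℝ, s < t → t < 0 → ∀ x, v t x = heatExtension (v s) (t - s) x - oseenDuhamel 1 s v v t x)
    (hdiv : ∀ t < 0, VectorCalculus.IsDivFree (v t)) {t₀ : ℝ} (ht₀ : t₀ < 0)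
    {U : Set (EuclideanSpace ℝ (Fin 3))} (hU : IsOpen U) (hne : U.Nonempty) (hcurl : ∀ x ∈ U, curl (v t₀) x = 0)
    {t : ℝ} (ht : t < 0) (c : ℝ → EuclideanSpace ℝ (Fin 3)) (T : ℝ) : ¬ IsVortexLoop v t c T :=
  no_loop_of_eq_zero (eq_zero_of_openSet_curl_eq_zero hrate hcont hmild hdiv ht₀ hU hne hcurl) ht c T

/-- **Locally vanishing slices carry no loop** (`v(t₀,·) = 0` on a non-empty open set for one `t₀ < 0`).
[cite: KochNadirashviliSereginSverak2009, Remark 6.1 (arXiv:0709.3599 p. 11)] -/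
theorem no_loop_of_openSet_eq_zero (hrate : HasTypeITimeDecay C v)
    (hcont : ContinuousOn (uncurry v) (Iio (0 : ℝ) ×ˢ univ))
    (hmild : ∀ s t : ℝ, s < t → t < 0 → ∀ x, v t x = heatExtension (v s) (t - s) x - oseenDuhamel 1 s v v t x)
    (hdiv : ∀ t < 0, VectorCalculus.IsDivFree (v t)) {t₀ : ℝ} (ht₀ : t₀ < 0)
    {U : Set (EuclideanSpace ℝ (Fin 3))} (hU : IsOpen U) (hne : U.Nonempty) (h0 : ∀ x ∈ U, v t₀ x = 0)
    {t : ℝ} (ht : t < 0) (c : ℝ → EuclideanSpace ℝ (Fin 3)) (T : ℝ) : ¬ IsVortexLoop v t c T :=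
  no_loop_of_eq_zero (openSetVelocityLiouville (isTypeIAncientMild_of_class hrate hcont hmild hdiv) ht₀ hU hne h0) ht c T

end Summit.NavierStokesRegularity.NavierStokesRegularity.Theorems.FrequencyGrowthExponent.Negative

end
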